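import Mathlib

/-!
# A matrix coefficient of an irreducible representation is not identically zero (support, seat p1)

For a monoid homomorphism `τ : G →* (V →ₗ[ℂ] V)` on an inner product space `V` whose only `τ`-stable subspaces are
`⊥` and `⊤` (irreducibility), and non-zero vectors `u, w`, some `γ` has `⟪τ γ u, w⟫ ≠ 0`
(`exists_inner_apply_ne_zero`): the span of the orbit `{τ γ u}` is a non-zero stable subspace, hence `⊤`, and a
vector orthogonal to `⊤` is `0`. The same with the orbit-span hypothesis stated directly
(`exists_inner_apply_ne_zero_of_span`).

This is the bookkeeping of «the bi-period `γ ↦ ⟨τ(γ) u_B, u_A⟩` is a non-zero function of `γ` (`τ` irreducible,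
`u_A, u_B ≠ 0`)»; its real-analyticity and the choice of a rational `γ₀` outside the zero set are not here.
Blind lane: Mathlib only; no sorry; axioms ⊆ {propext, Classical.choice, Quot.sound}.
-/

namespace Summit.Ventures.HodgeRepro2.T7SupportCoefficientNonzero

open scoped InnerProductSpace

variable {G : Type*} [Monoid G] {V : Type*} [NormedAddCommGroup V] [InnerProductSpace ℂ V]

/-- the span of the orbit of `u` under `τ` is `τ`-stable -/
theorem orbitSpan_stable (τ : G →* (V →ₗ[ℂ] V)) (u : V) (g : G) :
    ∀ x ∈ Submodule.span ℂ (Set.range fun γ : G => τ γ u),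
      τ g x ∈ Submodule.span ℂ (Set.range fun γ : G => τ γ u) := by
  intro x hx
  induction hx using Submodule.span_induction with
  | mem y hy =>
    obtain ⟨γ, rfl⟩ := hy
    refine Submodule.subset_span ⟨g * γ, ?_⟩
    simp [map_mul]
  | zero => simp
  | add a b _ _ ha hb => rw [map_add]; exact Submodule.add_mem _ ha hb
  | smul c a _ ha => rw [map_smul]; exact Submodule.smul_mem _ c ha

/-- **a coefficient whose orbit spans is not identically zero**: if the orbit `{τ γ u}` spans `V` and `w ≠ 0`,
some `γ` has `⟪τ γ u, w⟫ ≠ 0`. -/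
theorem exists_inner_apply_ne_zero_of_span (τ : G →* (V →ₗ[ℂ] V)) (u w : V)
    (hspan : Submodule.span ℂ (Set.range fun γ : G => τ γ u) = ⊤) (hw : w ≠ 0) :
    ∃ γ : G, ⟪τ γ u, w⟫_ℂ ≠ 0 := by
  by_contra hcon
  push Not at hcon
  apply hw
  have hall : ∀ x ∈ Submodule.span ℂ (Set.range fun γ : G => τ γ u), ⟪x, w⟫_ℂ = 0 := by
    intro x hx
    induction hx using Submodule.span_induction with
    | mem y hy =>
      obtain ⟨γ, rfl⟩ := hy
      exact hcon γ
    | zero => simp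
    | add a b _ _ ha hb => rw [inner_add_left, ha, hb, add_zero]
    | smul c a _ ha => rw [inner_smul_left, ha, mul_zero]
  have := hall w (by rw [hspan]; exact Submodule.mem_top)
  exact inner_self_eq_zero.1 this

/-- **a matrix coefficient of an irreducible representation is not identically zero**: if the only `τ`-stable
subspaces are `⊥` and `⊤`, then for `u ≠ 0`, `w ≠ 0` some `γ` has `⟪τ γ u, w⟫ ≠ 0`. -/
theorem exists_inner_apply_ne_zero (τ : G →* (V →ₗ[ℂ] V))
    (hirr : ∀ W : Submodule ℂ V, (∀ g, ∀ x ∈ W, τ g x ∈ W) → W = ⊥ ∨ W = ⊤)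
    (u w : V) (hu : u ≠ 0) (hw : w ≠ 0) : ∃ γ : G, ⟪τ γ u, w⟫_ℂ ≠ 0 := by
  refine exists_inner_apply_ne_zero_of_span τ u w ?_ hw
  rcases hirr _ (orbitSpan_stable τ u) with h | h
  · exfalso
    have hmem : u ∈ Submodule.span ℂ (Set.range fun γ : G => τ γ u) :=
      Submodule.subset_span ⟨1, by simp⟩
    rw [h, Submodule.mem_bot] at hmem
    exact hu hmem
  · exact h

end Summit.Ventures.HodgeRepro2.T7SupportCoefficientNonzero
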